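import Summits.KontsevichZagierPeriods.KontsevichZagierPeriods.Theorems.RootDecompRationalCubeDichotomyNashMultiGenP16

/-!
# Route B — item 31659 `NashEtaleLocal`: the registered line `strata`, stub `stub_strata` BY NAME AND SIGNATURE

The registered skeleton «strata» on stmt-KontsevichZagierPeriods-31659 (writer decomp-kz-writer-1 g5, namespace `…Cruxes.NashEtaleLocal.Strata`; critic CLEARED
12:37:18Z) has three stubs: `stub_defectOne` (= item 33041 by name), `stub_special` (= item 33042 by name) and the kernel edge
`stub_strata : MultiGenDefectOne → MultiGenSpecial → NashEtaleLocal`.  This module proves `stub_strata` by the lens-2 g8 theorem `nashEtaleLocal_of_items`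
(NashEtaleMultiGen v8 @968f0f93 §6.8, landed in the census chain `…NashMultiGenP01–P16`); `Item33041 ↔ MultiGenDefectOne` and `Item33042 ↔ MultiGenSpecial` are `Iff.rfl`.
-/

set_option linter.dupNamespace false

namespace Summit.KontsevichZagierPeriods.KontsevichZagierPeriods.Cruxes.NashEtaleLocal.Strata

/-- the lens's mirror `Item33041` IS the born route decl `MultiGenDefectOne` -/
theorem item33041_iff_born : Summit.KontsevichZagierPeriods.RootDecompRationalCubeDichotomy.Rung29430.MultiGen.Item33041 ↔ Summit.KontsevichZagierPeriods.KontsevichZagierPeriods.Theses.RootDecompRationalCubeDichotomy.MultiGenDefectOne := Iff.rfl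

/-- the lens's mirror `Item33042` IS the born route decl `MultiGenSpecial` -/
theorem item33042_iff_born : Summit.KontsevichZagierPeriods.RootDecompRationalCubeDichotomy.Rung29430.MultiGen.Item33042 ↔ Summit.KontsevichZagierPeriods.KontsevichZagierPeriods.Theses.RootDecompRationalCubeDichotomy.MultiGenSpecial := Iff.rfl

/-- **`stub_strata` of line «strata» on item 31659, PROVED** (the kernel edge 33041 → 33042 → 31659: case split on the transcendence defect of the
point; defect 0 is the generic branch inside `NashEtaleLocal`'s own proof) — by `MultiGen.nashEtaleLocal_of_items`. -/
theorem stub_strata :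
    Summit.KontsevichZagierPeriods.KontsevichZagierPeriods.Theses.RootDecompRationalCubeDichotomy.MultiGenDefectOne →
      Summit.KontsevichZagierPeriods.KontsevichZagierPeriods.Theses.RootDecompRationalCubeDichotomy.MultiGenSpecial →
        Summit.KontsevichZagierPeriods.KontsevichZagierPeriods.Theses.RootDecompRationalCubeDichotomy.NashEtaleLocal :=
  fun h₁ h₂ => Summit.KontsevichZagierPeriods.RootDecompRationalCubeDichotomy.Rung29430.MultiGen.nashEtaleLocal_of_items (item33041_iff_born.mpr h₁) (item33042_iff_born.mpr h₂)

end Summit.KontsevichZagierPeriods.KontsevichZagierPeriods.Cruxes.NashEtaleLocal.Strata
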